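import Literature.AlgebraicGeometry.Milne1999.LefschetzGroupCentraliserInclusion
import Literature.AlgebraicGeometry.HodgeTheory.AbelianVarietyHodgeFullnessHolds
import HarnessLib

/-!
# Milne 1999, Theorem 4.4, the inclusion `G(A) ⊆ L(A)` on the first power: `S(A)(ℂ)` fixes the divisor classes of `A` (PROVED)

Family `hodge`, layer `Literature/AlgebraicGeometry/Milne1999`, namespace
`Literature.AlgebraicGeometry.Milne1999` (D-0022). Theorems only (no definition, no named fact, D-0026);
written for the cell `pub-hodgecm2` (COR-CM, Hodge ladder stage 2), binder table `HOME/lit/milne.md`, as a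
PROVED piece of the remaining (`⊇`) half of the cited record
`Milne1999_thm44_specialLefschetzGroup_one_eq_unitaryCentralizerGroup` of `Milne1999/LefschetzCentraliser`
(the `⊆` half is the theorem `specialLefschetzGroup_map_one_le_unitaryCentralizerGroup` of
`Milne1999/LefschetzGroupCentraliserInclusion`).

## Source read (held text `paper:doi-10-1215-s0012-7094-99-09620-5` = J. S. Milne, *Lefschetz classes on abelian varieties*, Duke Math. J. 96 (1999) 639–675, author version 1999aP), verbatim

* §4, p. 659 (held p0021 L14–L20): "**Theorem 4.4.** The map `γ ↦ (γ, γ†γ) : G(A) → GL(V(A)) × 𝔾_m`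
  sends `G(A)` isomorphically onto `L(A)`. Proof. For any `γ ∈ G(A)(k)` and divisor `D` on `A`,
  `e_D(γx, γy) = e_D(x, γ†γx) = γ†γ · e_D(x, y)`, all `x, y ∈ V(A)`, and so `(γ, γ†γ)` fixes `e_D`. It
  therefore fixes the class of `D` in `H²(A)(1)`. More generally, any `γ ∈ G(A)(k^al)` will fix all divisor
  classes on `A^r`, all `r`. This shows that `G(A) ⊂ L(A)`."
* §1, p. 644 (p0006 L16–L20): "`S(A)(R) = {γ ∈ C(A) ⊗_k R | γ†γ = 1}`. Thus, for any ample divisor `D` on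
  `A`, `S(A)` is the largest algebraic subgroup of `Sp(e_D)` whose elements commute with the endomorphisms
  of `A`."

## What is proved (the tree's carriers; `ℂ`-points, read on `H¹`, first power `r = 1`, multiplier `1`)

For a complex abelian variety `A`, a class `h ∈ H²(A(ℂ); ℂ)` which is rational with `s · h` Kähler for a
real `s > 0` (the class of an ample divisor up to a positive scalar), and
`u ∈ unitaryCentralizerGroup A h = S(A)(ℂ)` (an automorphism of `H¹(A(ℂ); ℂ)` commuting with every `φ^*`,
`φ ∈ End(A)`, and preserving `Q_h(x, y) = h^{dim A - 1} ∪ x ∪ y`), with `⋀•u` the multiplicative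
exterior action on `H•(A(ℂ); ℂ) = ⋀•H¹` (`HodgeTheory/ExteriorPullback`):

* **`exteriorPullback_eq_self_of_mem_divisorClassesSpan`** — `⋀^{2p}u` fixes every element of
  `divisorClassesSpan A.X (dim A) p = D^p_hom(A)_ℂ` (the span of `p`-fold cup products of rational
  `(1,1)`-classes), every `p`: Milne's "any `γ ∈ G(A)(k^al)` will fix all divisor classes on `A^r`" for
  `r = 1` and `γ†γ = 1`;
* `exteriorPullback_two_eq_self_of_mem_unitaryCentralizerGroup` — `⋀²u c = c` for every rational
  `(1,1)`-class `c` ("`(γ, γ†γ)` fixes `e_D` […] therefore fixes the class of `D` in `H²(A)(1)`");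
* `det_eq_one_of_mem_unitaryCentralizerGroup` — `det u = 1` (`S(A) ≤ SL(V(A))`);
* `eq_zero_of_forall_polarizationPairingOne_eq_zero_of_hasHardLefschetzProperty` — `Q_h` is
  non-degenerate as soon as `h` has the hard Lefschetz property (Poincaré duality).
* `…_of_nondegenerate` variants (`apply_contraction_eq_of_mem_unitaryCentralizerGroup_of_nondegenerate`,
  `exteriorPullback_two_eq_self_of_mem_unitaryCentralizerGroup_of_nondegenerate`,
  **`exteriorPullback_eq_self_of_mem_divisorClassesSpan_of_nondegenerate`**) — the same conclusions under
  the hypotheses the proof actually uses: `h ∈ B¹(A) ⊗ ℂ` (`VanGeemen1994.hodgeClassSpan A.dim A.X 1`, so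
  that `Hg(A)|_{H¹} ≤ S(A)(h)`) and `Q_h` NON-DEGENERATE on `H¹`. These are the hypotheses met by Milne's
  product divisor `D = Σᵢ A × ⋯ × Dᵢ × ⋯ × A` on a power `A^r` (§1 p. 643), whose class `Σᵢ prᵢ^* h` has no
  Kähler representative on the tree's carriers but inherits non-degeneracy blockwise; the Kähler-spelled
  theorems are their corollaries (hard Lefschetz, Voisin I Thm. 6.25).

## The proof (no Néron–Severi ↔ Rosati dictionary; Deligne's commutant theorem instead)

Milne's one-line argument presupposes the dictionary "divisor classes of `A` ↔ Riemann forms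
`e_D(x, y) = e(x, φ_D y)` with `φ_D ∈ Hom(A, A^∨)`", under which `γ ∈ C(A)` commutes with `φ_D`. On the
tree's carriers (`H¹(A(ℂ); ℂ)`, `End(A)` acting by `φ^*`, no dual abelian variety) the same mechanism is
run through the CONTRACTION VECTORS of `Milne1999/LefschetzGroupCentraliserInclusion`: write a rational
`(1,1)`-class as a `2`-vector `c = Σ_l a_l x_l ∪ y_l` (`H² = ⋀²H¹`) and put
`w_c(λ) = Σ_l a_l (λ(y_l) x_l - λ(x_l) y_l)` for a functional `λ` on `H¹`.
1. (`apply_one_contraction_eq_of_mem_hodgeGroup`) The Hodge group fixes `c` equivariantly: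
   `g₁ w_c(λ ∘ g₁) = w_c(λ)` for `g ∈ Hg(A)(ℂ)` — `Hg ≤ ker l(A)` (`hodgeGroup_le_specialLefschetzGroup`)
   and `apply_map_contraction_eq` of the inclusion file with `φ = 𝟙`.
2. (`eq_zero_of_forall_polarizationPairingOne_eq_zero_of_hasHardLefschetzProperty`) `Q_h` is
   non-degenerate: `Q_h(x, -) = 0` forces `L^{dim A - 1}_h x = 0` by Poincaré duality in degrees
   `(2 dim A - 1, 1)` (Hatcher Prop. 3.38, the tree's `isPerfPair_cupPairing_complexPoints`), hence `x = 0`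
   by hard Lefschetz in degree one (Voisin I Thm. 6.25, the tree's `IsKaehlerClass.hasHardLefschetzProperty`).
   So `Q♭ : H¹ → (H¹)^∨` is bijective, and `Q♭(e x) = Q♭(x) ∘ e⁻¹` for every isometry `e` of `Q_h` — the
   elements of `S(A)(ℂ)` by definition, and the `g₁`, `g ∈ Hg(A)(ℂ)`
   (`hodgeGroupOne_le_unitaryCentralizerGroup_of_isKaehlerClass`).
3. (`apply_contraction_eq_of_mem_unitaryCentralizerGroup`) Hence `T_c = W_c ∘ Q♭` commutes with
   `Hg(A)(ℂ)` on `H¹`, so lies in the `ℂ`-span of the `φ^*`, `φ ∈ End(A)` — Deligne 1982, I, proof of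
   Prop. 5.1 with Prop. 3.4, granted Riemann's theorem (Deligne–Milne II Thm. 6.20), the tree's
   `Deligne1982.mem_span_complexBetti_map_of_commute_hodgeGroup_of_riemann` fed with the PROVED
   `deligneMilne1982_Thm_6_20_full_holds` — and therefore commutes with `u ∈ C(A) ⊗ ℂ`; unwinding with
   `Q♭(u x) = Q♭(x) ∘ u⁻¹` and the surjectivity of `Q♭`: `u w_c(λ ∘ u) = w_c(λ)` for all `λ`.
4. (`exteriorPullback_two_eq_self_of_mem_unitaryCentralizerGroup`) The basis identity
   `2c = Σ_i w_c(β_i) ∪ b_i` (`b_i` a basis of `H¹`, `β_i` its coordinates; graded commutativity) turns the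
   `u`-equivariance of `w_c` into `Σ_l a_l · u x_l ∪ u y_l = c`, i.e. `⋀²u c = c`; multiplicativity of `⋀•u`
   gives the divisor monomials of all degrees, and `⋀^{2 dim A}u = det u` on `h^{dim A} ≠ 0` gives `det u = 1`.

## What is NOT here

* The powers `A^r`, `r ≥ 2` (Milne's "all divisor classes on `A^r`, all `r`"), i.e. the membership of
  `u` in `{g₁ | g ∈ specialLefschetzGroup (dim A) A.X}`: it needs the Künneth family `⋀•(u ⊕ ⋯ ⊕ u)` on the
  carriers `cartesianPow A.X (a + 1)` (the diagonal `u ⊕ ⋯ ⊕ u ∈ S(A^{a+1})(Σᵢ prᵢ^* h)` is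
  `Milne1999/LefschetzCentraliserPowers`; the present file's `_of_nondegenerate` theorems are then applied
  to `A^{a+1}` itself).
* The similitude group `G(A)` with multiplier `γ†γ ≠ 1` (Tate twist) and Milne's algebraic groups over `k`;
  only `S(A)(ℂ)` and Betti cohomology of complex abelian varieties occur.

## References

* [Milne1999LefschetzClasses] J. S. Milne, Lefschetz classes on abelian varieties, Duke Math. J. 96
  (1999) 639–675: §1 p. 644 (`S(A)`), §4 Thm. 4.4 with proof, p. 659.
* [Deligne1982HodgeCycles] P. Deligne, Hodge cycles on abelian varieties (notes by J. S. Milne), in LNM 900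
  (1982): I §3 Prop. 3.4, I §5 proof of Prop. 5.1 (the commutant of the Hodge group).
* [DeligneMilne1982Tannakian] P. Deligne, J. S. Milne, Tannakian categories, LNM 900 (1982): II Thm. 6.20
  (Riemann's theorem).
* [HatcherAT2002] A. Hatcher, Algebraic Topology (2002), §3.2 Thm. 3.11 (graded commutativity) and
  p. 211 (associativity), §3.3 Prop. 3.38 (the cup-product pairing is non-singular over a field).
* [VoisinHodgeI2002] C. Voisin, Hodge Theory and Complex Algebraic Geometry I (2002), Thm. 6.25 (hard
  Lefschetz), §3.1.3 Cor. 3.9 (`[ω]ⁿ ≠ 0`).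
* [LangeBirkenhake1992] H. Lange, Ch. Birkenhake, Complex Abelian Varieties, Lemma 1.1.17 and Exercise
  1.1.6 (7)–(8) (`H• = ⋀•H¹`).
-/

noncomputable section

open CategoryTheory MonoidalCategory CartesianMonoidalCategory
open Literature.AlgebraicTopology.SingularHomology
open Literature.AlgebraicGeometry.HodgeTheory
open Literature.AlgebraicGeometry.Motives
open Literature.AlgebraicGeometry.VanGeemen1994 (pullbackOne hodgeGroupOne mem_hodgeGroupOne_iff hodgeClassSpan)
open Literature.Barriers.HodgeConjecture (divisorClassesSpan divisorMonomials mem_divisorMonomials_zero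
  mem_divisorMonomials_succ)
open Literature.Geometry.Kaehler (lefschetzPow lefschetzOperator lefschetzPow_succ lefschetzPow_zero
  lefschetzOperator_apply HasHardLefschetzProperty)

namespace Literature.AlgebraicGeometry.Milne1999

/-! ### Non-degeneracy of the polarization pairing `Q_h(x, y) = h^{dim A - 1} ∪ x ∪ y` -/

section PolarizationPairing

variable {A : AbelianVariety ℂ}

/-- `(Lᵐ_h x) ∪ y = Lᵐ_h (x ∪ y)` for degree-one classes (associativity of the cup product).
[cite: HatcherAT2002, §3.2 p. 211] -/
private theorem cupProduct_lefschetzPow_one (h : complexBetti A.X 2) (x y : complexBetti A.X 1) :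
    ∀ (m : ℕ) (e : (1 + 2 * m) + 1 = 2 + 2 * m),
      cupProduct e (lefschetzPow h m 1 x) y =
        lefschetzPow h m 2 (cupProduct (rfl : 1 + 1 = 2) x y)
  | 0, _ => rfl
  | m + 1, e => by
    rw [lefschetzPow_succ, lefschetzPow_succ, LinearMap.comp_apply, LinearMap.comp_apply,
      lefschetzOperator_apply, lefschetzOperator_apply,
      ← cupProduct_lefschetzPow_one h x y m (by omega)]
    exact cupProduct_assoc _ _ _ _ h (lefschetzPow h m 1 x) y

/-- Transport of the vanishing of a cup product along equal degree targets. [folklore] -/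
private theorem cupProduct_eq_zero_iff_of_deg_eq {p q d₁ d₂ : ℕ} (h₁ : p + q = d₁) (h₂ : p + q = d₂)
    (a : complexBetti A.X p) (b : complexBetti A.X q) :
    cupProduct h₁ a b = 0 ↔ cupProduct h₂ a b = 0 := by
  obtain rfl : d₁ = d₂ := h₁.symm.trans h₂
  exact Iff.rfl

/-- **`Q_h` is non-degenerate when `h` has the hard Lefschetz property** (`dim A ≥ 1`): if
`Q_h(x, y) = h^{dim A - 1} ∪ x ∪ y = 0` for all `y ∈ H¹(A(ℂ); ℂ)`, then `L^{dim A - 1}_h x ∈ H^{2 dim A - 1}`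
pairs to zero with `H¹`, so vanishes by Poincaré duality over the field `ℂ` (Hatcher Prop. 3.38, the tree's
`isPerfPair_cupPairing_complexPoints`), and `x = 0` by hard Lefschetz in degree one (Voisin I Thm. 6.25).
[cite: HatcherAT2002, §3.3 Prop. 3.38] [cite: VoisinHodgeI2002, Thm. 6.25] -/
theorem eq_zero_of_forall_polarizationPairingOne_eq_zero_of_hasHardLefschetzProperty (hn : 1 ≤ A.dim)
    {h : complexBetti A.X 2} (hHL : HasHardLefschetzProperty h A.dim) {x : complexBetti A.X 1}
    (hx : ∀ y, polarizationPairingOne A.X h (A.dim - 1) x y = 0) : x = 0 := by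
  have hX : IsSmoothProjective A.dim A.X := AbelianVariety.isSmoothProjective_holds (A := A)
  have had : (1 + 2 * (A.dim - 1)) + 1 = 2 * A.dim := by omega
  have hperf := isPerfPair_cupPairing_complexPoints complexOrientationFamily hX had
  have hL0 : lefschetzPow h (A.dim - 1) 1 x = 0 := by
    refine hperf.1.1 ?_
    rw [map_zero]
    ext y
    rw [cupPairing_apply, LinearMap.zero_apply]
    have h0 : cupProduct had (lefschetzPow h (A.dim - 1) 1 x) y = 0 := by
      rw [cupProduct_eq_zero_iff_of_deg_eq had (by omega : (1 + 2 * (A.dim - 1)) + 1 = 2 + 2 * (A.dim - 1)),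
        cupProduct_lefschetzPow_one h x y (A.dim - 1), ← polarizationPairingOne_apply]
      exact hx y
    rw [h0, LinearMap.map_zero₂]
  exact (hHL (A.dim - 1) 1 (by omega)).1 (by rw [hL0, map_zero])

/-- Hard Lefschetz for `h` from a Kähler multiple `s · h`, `s ≠ 0` (Voisin I Thm. 6.25 for the Kähler
class, the tree's `IsKaehlerClass.hasHardLefschetzProperty` with hodge.S14 discharged, and
`HasHardLefschetzProperty.smul`). [cite: VoisinHodgeI2002, Thm. 6.25 and Rem. 6.27] -/
private theorem hasHardLefschetzProperty_of_isKaehlerClass_smul {h : complexBetti A.X 2} {s : ℝ}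
    (hs : s ≠ 0) (hK : IsKaehlerClass A.dim A.X ((s : ℂ) • h)) : HasHardLefschetzProperty h A.dim := by
  have hX : IsSmoothProjective A.dim A.X := AbelianVariety.isSmoothProjective_holds (A := A)
  have h1 := HasHardLefschetzProperty.smul
    (hK.hasHardLefschetzProperty hX fun _ ↦ Motives.hasHardLefschetzProperty_kaehlerClass_holds)
    (inv_ne_zero (Complex.ofReal_ne_zero.2 hs))
  rwa [smul_smul, inv_mul_cancel₀ (Complex.ofReal_ne_zero.2 hs), one_smul] at h1

end PolarizationPairing

/-! ### The basis identity `2 · x ∪ y = Σ_i (β_i(y) x - β_i(x) y) ∪ b_i` and its consequence for the contraction vectors -/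

section Contraction

variable {A : AbelianVariety ℂ} {ι : Type} [Fintype ι] {κ : Type*} [Fintype κ]

/-- For a basis `b` of `H¹(A(ℂ); ℂ)` with coordinate functionals `β_i`:
`2 · x ∪ y = Σ_i (β_i(y) x - β_i(x) y) ∪ b_i` (bilinearity, `Σ_i β_i(v) b_i = v`, and graded
commutativity `y ∪ x = -x ∪ y`). [cite: HatcherAT2002, §3.2 Thm. 3.11] -/
private theorem two_smul_cupProduct_eq_sum_basis (b : Module.Basis κ ℂ (complexBetti A.X 1))
    (x y : complexBetti A.X 1) :
    (2 : ℂ) • cupProduct (rfl : 1 + 1 = 2) x y =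
      ∑ i, cupProduct (rfl : 1 + 1 = 2) (b.coord i y • x - b.coord i x • y) (b i) := by
  have expand : ∀ v w : complexBetti A.X 1,
      ∑ i, cupProduct (rfl : 1 + 1 = 2) (b.coord i w • v) (b i) = cupProduct (rfl : 1 + 1 = 2) v w := by
    intro v w
    calc ∑ i, cupProduct (rfl : 1 + 1 = 2) (b.coord i w • v) (b i)
        = ∑ i, cupProduct (rfl : 1 + 1 = 2) v (b.coord i w • b i) := by
          refine Finset.sum_congr rfl fun i _ ↦ ?_
          rw [map_smul, LinearMap.smul_apply, map_smul]
      _ = cupProduct (rfl : 1 + 1 = 2) v (∑ i, b.coord i w • b i) := by rw [map_sum]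
      _ = cupProduct (rfl : 1 + 1 = 2) v w := by simp_rw [Module.Basis.coord_apply, Module.Basis.sum_repr]
  simp only [map_sub, LinearMap.sub_apply, Finset.sum_sub_distrib, expand]
  rw [cupProduct_gradedComm_holds ℂ (ComplexPoints A.X) (rfl : 1 + 1 = 2) rfl y x, two_smul, mul_one,
    pow_one, neg_one_smul, sub_neg_eq_add]

/-- The basis identity for a `2`-vector `c = Σ_l a_l x_l ∪ y_l` and its contraction vectors
`w_c(λ) = Σ_l a_l (λ(y_l) x_l - λ(x_l) y_l)`: **`2c = Σ_i w_c(β_i) ∪ b_i`**. [cite: HatcherAT2002, §3.2 Thm. 3.11] -/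
private theorem two_smul_sum_smul_cupProduct_eq_sum_basis (b : Module.Basis κ ℂ (complexBetti A.X 1))
    (a : ι → ℂ) (x y : ι → complexBetti A.X 1) :
    (2 : ℂ) • ∑ l, a l • cupProduct (rfl : 1 + 1 = 2) (x l) (y l) =
      ∑ i, cupProduct (rfl : 1 + 1 = 2)
        (∑ l, a l • (b.coord i (y l) • x l - b.coord i (x l) • y l)) (b i) := by
  calc (2 : ℂ) • ∑ l, a l • cupProduct (rfl : 1 + 1 = 2) (x l) (y l)
      = ∑ l, a l • ((2 : ℂ) • cupProduct (rfl : 1 + 1 = 2) (x l) (y l)) := by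
        rw [Finset.smul_sum]
        exact Finset.sum_congr rfl fun l _ ↦ smul_comm _ _ _
    _ = ∑ l, ∑ i, a l • cupProduct (rfl : 1 + 1 = 2)
          (b.coord i (y l) • x l - b.coord i (x l) • y l) (b i) := by
        simp_rw [two_smul_cupProduct_eq_sum_basis b, Finset.smul_sum]
    _ = ∑ i, ∑ l, a l • cupProduct (rfl : 1 + 1 = 2)
          (b.coord i (y l) • x l - b.coord i (x l) • y l) (b i) := Finset.sum_comm
    _ = ∑ i, cupProduct (rfl : 1 + 1 = 2)
          (∑ l, a l • (b.coord i (y l) • x l - b.coord i (x l) • y l)) (b i) := by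
        simp_rw [map_sum, map_smul, LinearMap.sum_apply, LinearMap.smul_apply]

/-- **Equivariance of the contraction vectors forces invariance of the `2`-vector.** If an automorphism
`u` of `H¹(A(ℂ); ℂ)` satisfies `u w_c(μ ∘ u) = w_c(μ)` for every functional `μ`, then
`Σ_l a_l · u x_l ∪ u y_l = Σ_l a_l · x_l ∪ y_l` (compare the basis identities of the two `2`-vectors and
cancel `2`). [cite: HatcherAT2002, §3.2 Thm. 3.11] [cite: LangeBirkenhake1992, Lemma 1.1.17] -/
private theorem sum_smul_cupProduct_apply_apply_eq_of_forall_dual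
    (u : complexBetti A.X 1 ≃ₗ[ℂ] complexBetti A.X 1) (a : ι → ℂ) (x y : ι → complexBetti A.X 1)
    (H : ∀ μ : Module.Dual ℂ (complexBetti A.X 1),
      u (∑ l, a l • (μ (u (y l)) • x l - μ (u (x l)) • y l)) =
        ∑ l, a l • (μ (y l) • x l - μ (x l) • y l)) :
    ∑ l, a l • cupProduct (rfl : 1 + 1 = 2) (u (x l)) (u (y l)) =
      ∑ l, a l • cupProduct (rfl : 1 + 1 = 2) (x l) (y l) := by
  haveI : Module.Finite ℂ (complexBetti A.X 1) := abelianVarietyCohomologyExteriorH1_holds.finite_one A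
  let b := Module.finBasis ℂ (complexBetti A.X 1)
  have hlin : ∀ μ : Module.Dual ℂ (complexBetti A.X 1),
      ∑ l, a l • (μ (u (y l)) • u (x l) - μ (u (x l)) • u (y l)) =
        u (∑ l, a l • (μ (u (y l)) • x l - μ (u (x l)) • y l)) := by
    intro μ
    simp only [map_sum, map_smul, map_sub]
  have e : (2 : ℂ) • ∑ l, a l • cupProduct (rfl : 1 + 1 = 2) (u (x l)) (u (y l)) =
      (2 : ℂ) • ∑ l, a l • cupProduct (rfl : 1 + 1 = 2) (x l) (y l) := by
    rw [two_smul_sum_smul_cupProduct_eq_sum_basis b a (fun l ↦ u (x l)) (fun l ↦ u (y l)),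
      two_smul_sum_smul_cupProduct_eq_sum_basis b a x y]
    refine Finset.sum_congr rfl fun i _ ↦ ?_
    rw [hlin (b.coord i), H (b.coord i)]
  exact smul_right_injective _ (two_ne_zero (α := ℂ)) e

end Contraction

/-! ### `S(A)(ℂ)` moves the contraction vectors of every rational `(1,1)`-class equivariantly -/

section Main

variable {A : AbelianVariety ℂ} {ι : Type} [Fintype ι]

/-- `𝟙^* = id` on `H¹`. [folklore] -/
private theorem map_id_one (z : complexBetti A.X 1) :
    complexBetti.map (𝟙 A : A ⟶ A).hom.hom.hom 1 z = z := by
  change complexBetti.map (𝟙 A.X) 1 z = z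
  rw [complexBetti.map_id]
  rfl

/-- An automorphism of `H¹(A(ℂ); ℂ)` commuting with every `φ^*`, `φ ∈ End(A)`, commutes with every element
of their `ℂ`-span. [cite: Milne1999LefschetzClasses, §1 p. 642 (`C(A)`, the centralizer of `End⁰(A)`)] -/
private theorem apply_apply_eq_of_mem_span {u : complexBetti A.X 1 ≃ₗ[ℂ] complexBetti A.X 1}
    (hu : u ∈ centralizerGroup A) {S : complexBetti A.X 1 →ₗ[ℂ] complexBetti A.X 1}
    (hS : S ∈ Submodule.span ℂ (Set.range fun φ : (A ⟶ A) ↦ (complexBetti.map φ.hom.hom.hom 1).hom))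
    (z : complexBetti A.X 1) : u (S z) = S (u z) := by
  induction hS using Submodule.span_induction generalizing z with
  | mem S hS =>
    obtain ⟨φ, rfl⟩ := hS
    exact (mem_centralizerGroup_iff.1 hu) φ z
  | zero => simp
  | add S S' _ _ hS hS' => rw [LinearMap.add_apply, LinearMap.add_apply, map_add, hS, hS']
  | smul r S _ hS => rw [LinearMap.smul_apply, LinearMap.smul_apply, map_smul, hS]

/-- **The Hodge group moves the contraction vectors of a rational `(1,1)`-class equivariantly.** For
`dim A ≥ 1`, a rational `(1,1)`-class `c = Σ_l a_l x_l ∪ y_l ∈ H²(A(ℂ); ℂ)`, `g ∈ Hg(A)(ℂ)` (the tree's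
`hodgeGroup (dim A) A.X`) and every functional `λ` on `H¹(A(ℂ); ℂ)`:
`g₁ (Σ_l a_l (λ(g₁y_l) x_l - λ(g₁x_l) y_l)) = Σ_l a_l (λ(y_l) x_l - λ(x_l) y_l)`, i.e.
`g₁ w_c(λ ∘ g₁) = w_c(λ)`. (`Hg(A) ≤ ker l(A)`, Milne (4.8)/p. 660, the tree's
`hodgeGroup_le_specialLefschetzGroup`; then `apply_map_contraction_eq` with `φ = 𝟙`.)
[cite: Milne1999LefschetzClasses, Thm. 4.4 (proof) and p. 660 (`L(A) ⊃ MT(A)`)] [cite: HatcherAT2002, §3.2 Thm. 3.16] -/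
theorem apply_one_contraction_eq_of_mem_hodgeGroup (hn : 1 ≤ A.dim) {c : complexBetti A.X 2}
    (hcQ : IsRationalClass c) (hc11 : IsOfHodgeType A.dim A.X 2 1 1 c) (a : ι → ℂ)
    (x y : ι → complexBetti A.X 1) (hc : c = ∑ l, a l • cupProduct (rfl : 1 + 1 = 2) (x l) (y l))
    {g : ∀ k : ℕ, complexBetti A.X k ≃ₗ[ℂ] complexBetti A.X k} (hg : g ∈ hodgeGroup A.dim A.X)
    (lam : Module.Dual ℂ (complexBetti A.X 1)) :
    g 1 (∑ l, a l • (lam (g 1 (y l)) • x l - lam (g 1 (x l)) • y l)) =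
      ∑ l, a l • (lam (y l) • x l - lam (x l) • y l) := by
  have hX : IsSmoothProjective A.dim A.X := AbelianVariety.isSmoothProjective_holds (A := A)
  obtain ⟨G, hG, h0, hfix⟩ := hodgeGroup_le_specialLefschetzGroup hX hg
  have k0 := apply_map_contraction_eq hG h0 rfl hfix hn hcQ hc11 a x y hc (𝟙 A) lam
  rwa [map_id_one, map_id_one] at k0

/-- A rational class with a Kähler multiple `s · h`, `s ≠ 0`, lies in `B¹(A) ⊗ ℂ = hodgeClassSpan A.dim A.X 1`
(Kähler classes are of type `(1,1)`, `IsKaehlerClass.isOfHodgeType_one_one`). [cite: VoisinHodgeI2002, §7.1.2] -/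
private theorem mem_hodgeClassSpan_of_isKaehlerClass_smul {h : complexBetti A.X 2} (hQ : IsRationalClass h)
    {s : ℝ} (hs : s ≠ 0) (hK : IsKaehlerClass A.dim A.X ((s : ℂ) • h)) : h ∈ hodgeClassSpan A.dim A.X 1 := by
  have h11 : IsOfHodgeType A.dim A.X 2 1 1 h := by
    have e := (hK.isOfHodgeType_one_one).smul ((s : ℂ)⁻¹)
    rwa [smul_smul, inv_mul_cancel₀ (Complex.ofReal_ne_zero.2 hs), one_smul] at e
  exact Submodule.subset_span
    (show h ∈ {c : complexBetti A.X (2 * 1) | IsRationalClass c ∧ IsOfHodgeType A.dim A.X (2 * 1) 1 1 c}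
      from ⟨hQ, h11⟩)

/-- `Q_h` is non-degenerate on `H¹(A(ℂ); ℂ)` for `h` with a Kähler multiple `s · h`, `s ≠ 0` (hard Lefschetz and
Poincaré duality, `eq_zero_of_forall_polarizationPairingOne_eq_zero_of_hasHardLefschetzProperty`; in
dimension `0` the group `H¹` vanishes). [cite: VoisinHodgeI2002, Thm. 6.25] [cite: HatcherAT2002, §3.3 Prop. 3.38] -/
private theorem eq_zero_of_forall_polarizationPairingOne_eq_zero_of_isKaehlerClass_smul
    {h : complexBetti A.X 2} {s : ℝ} (hs : s ≠ 0) (hK : IsKaehlerClass A.dim A.X ((s : ℂ) • h))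
    (x : complexBetti A.X 1) (hx : ∀ y, polarizationPairingOne A.X h (A.dim - 1) x y = 0) : x = 0 := by
  rcases Nat.eq_zero_or_pos A.dim with hA | hn
  · haveI : Module.Finite ℂ (complexBetti A.X 1) := abelianVarietyCohomologyExteriorH1_holds.finite_one A
    have hV : Module.finrank ℂ (complexBetti A.X 1) = 0 := by
      rw [AbelianVariety.finrank_complexBetti_one, hA, mul_zero]
    haveI : Subsingleton (complexBetti A.X 1) := Module.finrank_zero_iff.1 hV
    exact Subsingleton.elim _ _
  · exact eq_zero_of_forall_polarizationPairingOne_eq_zero_of_hasHardLefschetzProperty hn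
      (hasHardLefschetzProperty_of_isKaehlerClass_smul hs hK) hx

/-- **`S(A)(ℂ)` moves the contraction vectors of every rational `(1,1)`-class equivariantly — the form the
proof uses (`h ∈ B¹(A) ⊗ ℂ`, `Q_h` NON-DEGENERATE).** For `dim A ≥ 1`, `h ∈ hodgeClassSpan A.dim A.X 1` (the
`ℂ`-span of the rational `(1,1)`-classes, so that `Hg(A)(ℂ)|_{H¹} ≤ S(A)(h)`,
`hodgeGroupOne_le_unitaryCentralizerGroup`) whose pairing `Q_h(x, y) = h^{dim A - 1} ∪ x ∪ y` is
non-degenerate on `H¹(A(ℂ); ℂ)`, `u ∈ unitaryCentralizerGroup A h = S(A)(ℂ)`, a rational `(1,1)`-class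
`c = Σ_l a_l x_l ∪ y_l` and every functional `μ`: `u w_c(μ ∘ u) = w_c(μ)`. This is the hypothesis set met
by the product classes `Σᵢ prᵢ^* h` on the powers `A^r` (Milne: "any `γ ∈ G(A)(k^al)` will fix all divisor
classes on `A^r`, all `r`"), where the tree has no Kähler class but non-degeneracy is inherited blockwise
(§1 p. 643, "`C(A)` with `C(A^r)` as `k`-algebras with involution").
Proof: `Q♭_h : H¹ → (H¹)^∨` is bijective and intertwines every isometry `e` of `Q_h` with `λ ↦ λ ∘ e⁻¹`;
`T_c = W_c ∘ Q♭_h` therefore commutes with `Hg(A)(ℂ)|_{H¹}` (`apply_one_contraction_eq_of_mem_hodgeGroup`),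
hence lies in the `ℂ`-span of the `φ^*` (Deligne 1982, I, proof of Prop. 5.1 with Prop. 3.4, granted
Riemann's theorem Deligne–Milne II Thm. 6.20 — the tree's
`Deligne1982.mem_span_complexBetti_map_of_commute_hodgeGroup_of_riemann` with the PROVED
`deligneMilne1982_Thm_6_20_full_holds`), hence commutes with `u`; unwind.
[cite: Milne1999LefschetzClasses, Thm. 4.4 (proof, p. 659) and §1 pp. 643–644]
[cite: Deligne1982HodgeCycles, I §5 Prop. 5.1 (proof) and I §3 Prop. 3.4]
[cite: DeligneMilne1982Tannakian, II Thm. 6.20] -/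
theorem apply_contraction_eq_of_mem_unitaryCentralizerGroup_of_nondegenerate (hn : 1 ≤ A.dim)
    {h : complexBetti A.X 2} (hh : h ∈ hodgeClassSpan A.dim A.X 1)
    (hnd : ∀ x : complexBetti A.X 1, (∀ y, polarizationPairingOne A.X h (A.dim - 1) x y = 0) → x = 0)
    {u : complexBetti A.X 1 ≃ₗ[ℂ] complexBetti A.X 1} (hu : u ∈ unitaryCentralizerGroup A h)
    {c : complexBetti A.X 2} (hcQ : IsRationalClass c) (hc11 : IsOfHodgeType A.dim A.X 2 1 1 c)
    (a : ι → ℂ) (x y : ι → complexBetti A.X 1)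
    (hc : c = ∑ l, a l • cupProduct (rfl : 1 + 1 = 2) (x l) (y l))
    (μ : Module.Dual ℂ (complexBetti A.X 1)) :
    u (∑ l, a l • (μ (u (y l)) • x l - μ (u (x l)) • y l)) =
      ∑ l, a l • (μ (y l) • x l - μ (x l) • y l) := by
  classical
  haveI : Module.Finite ℂ (complexBetti A.X 1) := abelianVarietyCohomologyExteriorH1_holds.finite_one A
  haveI : Module.Finite ℂ (complexBetti A.X (2 + 2 * (A.dim - 1))) :=
    abelianVarietyCohomologyExteriorH1_holds.finite A _
  -- the contraction map `W = W_c : (H¹)^∨ → H¹`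
  let W : Module.Dual ℂ (complexBetti A.X 1) →ₗ[ℂ] complexBetti A.X 1 :=
    ∑ l, a l • ((Module.Dual.eval ℂ (complexBetti A.X 1) (y l)).smulRight (x l) -
      (Module.Dual.eval ℂ (complexBetti A.X 1) (x l)).smulRight (y l))
  have hW : ∀ lam, W lam = ∑ l, a l • (lam (y l) • x l - lam (x l) • y l) := by
    intro lam
    simp only [W, LinearMap.sum_apply, LinearMap.smul_apply, LinearMap.sub_apply,
      LinearMap.smulRight_apply, Module.Dual.eval_apply]
  -- (1) Hodge-group equivariance of `W`
  have hHg : ∀ g ∈ hodgeGroup A.dim A.X, ∀ lam : Module.Dual ℂ (complexBetti A.X 1),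
      g 1 (W (lam.comp (g 1 : complexBetti A.X 1 →ₗ[ℂ] complexBetti A.X 1))) = W lam := by
    intro g hg lam
    rw [hW, hW]
    simp only [LinearMap.comp_apply, LinearEquiv.coe_coe]
    exact apply_one_contraction_eq_of_mem_hodgeGroup hn hcQ hc11 a x y hc hg lam
  -- (2) `Q♭ : H¹ → (H¹)^∨`, through a trivialisation `τ` of the line `H^{2 + 2(dim A - 1)} = H^{2 dim A}`
  have h1 : Module.finrank ℂ (complexBetti A.X (2 + 2 * (A.dim - 1))) = Module.finrank ℂ ℂ := by
    rw [Module.finrank_self, abelianVarietyCohomologyExteriorH1_holds.finrank_eq,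
      show 2 + 2 * (A.dim - 1) = 2 * A.dim by omega, Nat.choose_self]
  let τ : complexBetti A.X (2 + 2 * (A.dim - 1)) ≃ₗ[ℂ] ℂ := LinearEquiv.ofFinrankEq _ _ h1
  let Qf : complexBetti A.X 1 →ₗ[ℂ] Module.Dual ℂ (complexBetti A.X 1) :=
    (polarizationPairingOne A.X h (A.dim - 1)).compr₂ τ.toLinearMap
  have hQf : ∀ v w, Qf v w = τ (polarizationPairingOne A.X h (A.dim - 1) v w) := fun v w ↦ rfl
  have hQf_inj : Function.Injective Qf := by
    rw [← LinearMap.ker_eq_bot, LinearMap.ker_eq_bot']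
    intro v hv
    refine hnd v fun w ↦ ?_
    have e := LinearMap.congr_fun hv w
    rwa [hQf, LinearMap.zero_apply, map_eq_zero_iff _ τ.injective] at e
  have hQf_surj : Function.Surjective Qf :=
    (LinearMap.injective_iff_surjective_of_finrank_eq_finrank Subspace.dual_finrank_eq.symm).1 hQf_inj
  -- isometries of `Q_h` act on `Q♭` by composition with the inverse
  have hQf_iso : ∀ e : complexBetti A.X 1 ≃ₗ[ℂ] complexBetti A.X 1,
      (∀ v w, polarizationPairingOne A.X h (A.dim - 1) (e v) (e w) =
        polarizationPairingOne A.X h (A.dim - 1) v w) →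
      ∀ v, Qf (e v) = (Qf v).comp (e.symm : complexBetti A.X 1 →ₗ[ℂ] complexBetti A.X 1) := by
    intro e he v
    ext w
    rw [LinearMap.comp_apply, hQf, hQf, LinearEquiv.coe_coe]
    congr 1
    conv_lhs => rw [← e.apply_symm_apply w]
    exact he v (e.symm w)
  -- (3) `T = W ∘ Q♭` commutes with the Hodge group, hence lies in the span of the `φ^*`
  have hT : ∀ g ∈ hodgeGroup A.dim A.X, ∀ z : complexBetti A.X 1,
      (W.comp Qf) (g 1 z) = g 1 ((W.comp Qf) z) := by
    intro g hg z
    have hgQ : ∀ v w, polarizationPairingOne A.X h (A.dim - 1) (g 1 v) (g 1 w) =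
        polarizationPairingOne A.X h (A.dim - 1) v w :=
      (hodgeGroupOne_le_unitaryCentralizerGroup hh (mem_hodgeGroupOne_iff.2 ⟨g, hg, rfl⟩)).2
    have hcomp : ((Qf z).comp ((g 1).symm : complexBetti A.X 1 →ₗ[ℂ] complexBetti A.X 1)).comp
        (g 1 : complexBetti A.X 1 →ₗ[ℂ] complexBetti A.X 1) = Qf z := by
      ext v
      simp
    rw [LinearMap.comp_apply, LinearMap.comp_apply, hQf_iso (g 1) hgQ z]
    conv_rhs => rw [← hcomp]
    exact (hHg g hg _).symm
  have hTspan := Deligne1982.mem_span_complexBetti_map_of_commute_hodgeGroup_of_riemann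
    deligneMilne1982_Thm_6_20_full_holds A (W.comp Qf) hT
  -- (4) `u` commutes with `T`; unwind with `Q♭ (u z) = Q♭ z ∘ u⁻¹` and the surjectivity of `Q♭`
  obtain ⟨z, hz⟩ := hQf_surj (μ.comp (u : complexBetti A.X 1 →ₗ[ℂ] complexBetti A.X 1))
  have e1 := apply_apply_eq_of_mem_span hu.1 hTspan z
  rw [LinearMap.comp_apply, LinearMap.comp_apply, hQf_iso u hu.2 z, hz] at e1
  have hcomp : (μ.comp (u : complexBetti A.X 1 →ₗ[ℂ] complexBetti A.X 1)).comp
      (u.symm : complexBetti A.X 1 →ₗ[ℂ] complexBetti A.X 1) = μ := by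
    ext v
    simp
  rw [hcomp, hW, hW] at e1
  simpa only [LinearMap.comp_apply, LinearEquiv.coe_coe] using e1

/-- **`S(A)(ℂ)` moves the contraction vectors of every rational `(1,1)`-class equivariantly** — the heart
of "any `γ ∈ G(A)` will fix all divisor classes" (Thm. 4.4, proof) on the carriers. For `dim A ≥ 1`, `h`
rational with `s · h` Kähler (`s > 0`), `u ∈ unitaryCentralizerGroup A h = S(A)(ℂ)`, a rational
`(1,1)`-class `c = Σ_l a_l x_l ∪ y_l` and every functional `μ`: `u w_c(μ ∘ u) = w_c(μ)`.
Proof: `Q♭_h : H¹ → (H¹)^∨` is bijective (`Q_h` non-degenerate: hard Lefschetz and Poincaré duality) and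
intertwines every isometry `e` of `Q_h` with `λ ↦ λ ∘ e⁻¹`; `T_c = W_c ∘ Q♭_h` therefore commutes with
`Hg(A)(ℂ)|_{H¹}` (`apply_one_contraction_eq_of_mem_hodgeGroup` and `Hg(A)|_{H¹} ≤ S(A)`), hence lies in
the `ℂ`-span of the `φ^*` (Deligne 1982, I, proof of Prop. 5.1 with Prop. 3.4, granted Riemann's theorem
Deligne–Milne II Thm. 6.20 — the tree's `Deligne1982.mem_span_complexBetti_map_of_commute_hodgeGroup_of_riemann`
with the PROVED `deligneMilne1982_Thm_6_20_full_holds`), hence commutes with `u`; unwind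
(`apply_contraction_eq_of_mem_unitaryCentralizerGroup_of_nondegenerate`).
[cite: Milne1999LefschetzClasses, Thm. 4.4 (proof, p. 659) and §1 p. 644]
[cite: Deligne1982HodgeCycles, I §5 Prop. 5.1 (proof) and I §3 Prop. 3.4]
[cite: DeligneMilne1982Tannakian, II Thm. 6.20] -/
theorem apply_contraction_eq_of_mem_unitaryCentralizerGroup (hn : 1 ≤ A.dim) {h : complexBetti A.X 2}
    (hQ : IsRationalClass h) (hK : ∃ s : ℝ, 0 < s ∧ IsKaehlerClass A.dim A.X ((s : ℂ) • h))
    {u : complexBetti A.X 1 ≃ₗ[ℂ] complexBetti A.X 1} (hu : u ∈ unitaryCentralizerGroup A h)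
    {c : complexBetti A.X 2} (hcQ : IsRationalClass c) (hc11 : IsOfHodgeType A.dim A.X 2 1 1 c)
    (a : ι → ℂ) (x y : ι → complexBetti A.X 1)
    (hc : c = ∑ l, a l • cupProduct (rfl : 1 + 1 = 2) (x l) (y l))
    (μ : Module.Dual ℂ (complexBetti A.X 1)) :
    u (∑ l, a l • (μ (u (y l)) • x l - μ (u (x l)) • y l)) =
      ∑ l, a l • (μ (y l) • x l - μ (x l) • y l) := by
  obtain ⟨s, hs, hKs⟩ := hK
  exact apply_contraction_eq_of_mem_unitaryCentralizerGroup_of_nondegenerate hn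
    (mem_hodgeClassSpan_of_isKaehlerClass_smul hQ hs.ne' hKs)
    (eq_zero_of_forall_polarizationPairingOne_eq_zero_of_isKaehlerClass_smul hs.ne' hKs) hu hcQ hc11 a x y
    hc μ

/-- `⋀²u` fixes the `2`-vector of every rational `(1,1)`-class, for `u ∈ S(A)(h)` with `h ∈ B¹(A) ⊗ ℂ` and
`Q_h` non-degenerate (the form used on the powers `A^r`). [cite: Milne1999LefschetzClasses, Thm. 4.4 (proof, p. 659)]
[cite: LangeBirkenhake1992, Lemma 1.1.17] -/
theorem sum_smul_cupProduct_apply_apply_eq_of_mem_unitaryCentralizerGroup_of_nondegenerate (hn : 1 ≤ A.dim)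
    {h : complexBetti A.X 2} (hh : h ∈ hodgeClassSpan A.dim A.X 1)
    (hnd : ∀ x : complexBetti A.X 1, (∀ y, polarizationPairingOne A.X h (A.dim - 1) x y = 0) → x = 0)
    {u : complexBetti A.X 1 ≃ₗ[ℂ] complexBetti A.X 1} (hu : u ∈ unitaryCentralizerGroup A h)
    {c : complexBetti A.X 2} (hcQ : IsRationalClass c) (hc11 : IsOfHodgeType A.dim A.X 2 1 1 c)
    (a : ι → ℂ) (x y : ι → complexBetti A.X 1)
    (hc : c = ∑ l, a l • cupProduct (rfl : 1 + 1 = 2) (x l) (y l)) :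
    ∑ l, a l • cupProduct (rfl : 1 + 1 = 2) (u (x l)) (u (y l)) =
      ∑ l, a l • cupProduct (rfl : 1 + 1 = 2) (x l) (y l) :=
  sum_smul_cupProduct_apply_apply_eq_of_forall_dual u a x y fun μ ↦
    apply_contraction_eq_of_mem_unitaryCentralizerGroup_of_nondegenerate hn hh hnd hu hcQ hc11 a x y hc μ

/-- **`⋀²u` fixes the `2`-vector of every rational `(1,1)`-class**: for `u ∈ S(A)(ℂ)` and
`c = Σ_l a_l x_l ∪ y_l` rational of type `(1,1)`, `Σ_l a_l · u x_l ∪ u y_l = Σ_l a_l · x_l ∪ y_l`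
("`(γ, γ†γ)` fixes `e_D`", Thm. 4.4, proof). [cite: Milne1999LefschetzClasses, Thm. 4.4 (proof, p. 659)]
[cite: LangeBirkenhake1992, Lemma 1.1.17] -/
theorem sum_smul_cupProduct_apply_apply_eq_of_mem_unitaryCentralizerGroup (hn : 1 ≤ A.dim)
    {h : complexBetti A.X 2} (hQ : IsRationalClass h)
    (hK : ∃ s : ℝ, 0 < s ∧ IsKaehlerClass A.dim A.X ((s : ℂ) • h))
    {u : complexBetti A.X 1 ≃ₗ[ℂ] complexBetti A.X 1} (hu : u ∈ unitaryCentralizerGroup A h)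
    {c : complexBetti A.X 2} (hcQ : IsRationalClass c) (hc11 : IsOfHodgeType A.dim A.X 2 1 1 c)
    (a : ι → ℂ) (x y : ι → complexBetti A.X 1)
    (hc : c = ∑ l, a l • cupProduct (rfl : 1 + 1 = 2) (x l) (y l)) :
    ∑ l, a l • cupProduct (rfl : 1 + 1 = 2) (u (x l)) (u (y l)) =
      ∑ l, a l • cupProduct (rfl : 1 + 1 = 2) (x l) (y l) :=
  sum_smul_cupProduct_apply_apply_eq_of_forall_dual u a x y fun μ ↦
    apply_contraction_eq_of_mem_unitaryCentralizerGroup hn hQ hK hu hcQ hc11 a x y hc μ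

/-- **`S(A)(h)` fixes every divisor class of `A`, `⋀²u c = c`, for `h ∈ B¹(A) ⊗ ℂ` with `Q_h` non-degenerate**
(the form used on the powers `A^r`): `u ∈ unitaryCentralizerGroup A h`, `c` a rational `(1,1)`-class.
[cite: Milne1999LefschetzClasses, Thm. 4.4 (proof, p. 659)] [cite: LangeBirkenhake1992, Lemma 1.1.17 and Exercise 1.1.6 (7)] -/
theorem exteriorPullback_two_eq_self_of_mem_unitaryCentralizerGroup_of_nondegenerate {h : complexBetti A.X 2}
    (hh : h ∈ hodgeClassSpan A.dim A.X 1)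
    (hnd : ∀ x : complexBetti A.X 1, (∀ y, polarizationPairingOne A.X h (A.dim - 1) x y = 0) → x = 0)
    {u : complexBetti A.X 1 ≃ₗ[ℂ] complexBetti A.X 1} (hu : u ∈ unitaryCentralizerGroup A h)
    {c : complexBetti A.X 2} (hcQ : IsRationalClass c) (hc11 : IsOfHodgeType A.dim A.X 2 1 1 c) :
    exteriorPullback (AbelianVariety.hasExteriorCohomologyH1_complexPoints A)
      (u : complexBetti A.X 1 →ₗ[ℂ] complexBetti A.X 1) 2 c = c := by
  rcases Nat.eq_zero_or_pos A.dim with hA | hn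
  · haveI : Subsingleton (complexBetti A.X 2) :=
      abelianVarietyCohomologyExteriorH1_holds.subsingleton_of_lt A (by omega)
    exact Subsingleton.elim _ _
  -- `c` is a combination of cup products of degree-one classes (`H² = ⋀²H¹`)
  have hmem : c ∈ Submodule.span ℂ (Set.range (cupPowOne ℂ (ComplexPoints A.X) 2)) := by
    rw [abelianVarietyCohomologyExteriorH1_holds.span_range_cupPowOne A 2]
    exact Submodule.mem_top
  obtain ⟨f, hf⟩ := Finsupp.mem_span_range_iff_exists_finsupp.1 hmem
  have hc : c = ∑ l : f.support, f l • cupProduct (rfl : 1 + 1 = 2)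
      ((l : Fin 2 → complexBetti A.X 1) 0) ((l : Fin 2 → complexBetti A.X 1) 1) := by
    rw [← hf, Finsupp.sum, ← Finset.sum_coe_sort]
    refine Finset.sum_congr rfl fun l _ ↦ ?_
    rw [cupPowOne_succ, cupPowOne_one]
    rfl
  rw [hc, map_sum]
  simp_rw [map_smul, exteriorPullback_cupProduct_one_one, LinearEquiv.coe_coe]
  exact sum_smul_cupProduct_apply_apply_eq_of_mem_unitaryCentralizerGroup_of_nondegenerate hn hh hnd hu hcQ
    hc11 _ _ _ hc

/-- **`S(A)(ℂ)` fixes every divisor class of `A`: `⋀²u c = c`** for `u ∈ unitaryCentralizerGroup A h`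
(`h` rational with `s · h` Kähler, `s > 0`) and every rational `(1,1)`-class `c ∈ H²(A(ℂ); ℂ)` — Milne's
"`(γ, γ†γ)` fixes `e_D`. It therefore fixes the class of `D` in `H²(A)(1)`" for `γ†γ = 1`, on the carriers
(`H² = ⋀²H¹`, every class is a `2`-vector). [cite: Milne1999LefschetzClasses, Thm. 4.4 (proof, p. 659)]
[cite: LangeBirkenhake1992, Lemma 1.1.17 and Exercise 1.1.6 (7)] -/
theorem exteriorPullback_two_eq_self_of_mem_unitaryCentralizerGroup {h : complexBetti A.X 2}
    (hQ : IsRationalClass h) (hK : ∃ s : ℝ, 0 < s ∧ IsKaehlerClass A.dim A.X ((s : ℂ) • h))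
    {u : complexBetti A.X 1 ≃ₗ[ℂ] complexBetti A.X 1} (hu : u ∈ unitaryCentralizerGroup A h)
    {c : complexBetti A.X 2} (hcQ : IsRationalClass c) (hc11 : IsOfHodgeType A.dim A.X 2 1 1 c) :
    exteriorPullback (AbelianVariety.hasExteriorCohomologyH1_complexPoints A)
      (u : complexBetti A.X 1 →ₗ[ℂ] complexBetti A.X 1) 2 c = c := by
  obtain ⟨s, hs, hKs⟩ := hK
  exact exteriorPullback_two_eq_self_of_mem_unitaryCentralizerGroup_of_nondegenerate
    (mem_hodgeClassSpan_of_isKaehlerClass_smul hQ hs.ne' hKs)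
    (eq_zero_of_forall_polarizationPairingOne_eq_zero_of_isKaehlerClass_smul hs.ne' hKs) hu hcQ hc11

/-- **`S(A)(ℂ) ≤ SL(H¹(A(ℂ); ℂ))`: `det u = 1`** for `u ∈ unitaryCentralizerGroup A h` — `⋀²u` fixes `h`,
so `⋀u` fixes `h^{dim A} ≠ 0` in the top degree, where it is multiplication by `det u`.
[cite: Milne1999LefschetzClasses, §1 p. 644 (`S(A) ≤ Sp(e_D)`)] [cite: LangeBirkenhake1992, Lemma 1.1.17 and Exercise 1.1.6 (7)–(8)]
[cite: VoisinHodgeI2002, §3.1.3 Cor. 3.9] -/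
theorem det_eq_one_of_mem_unitaryCentralizerGroup {h : complexBetti A.X 2} (hQ : IsRationalClass h)
    (hK : ∃ s : ℝ, 0 < s ∧ IsKaehlerClass A.dim A.X ((s : ℂ) • h))
    {u : complexBetti A.X 1 ≃ₗ[ℂ] complexBetti A.X 1} (hu : u ∈ unitaryCentralizerGroup A h) :
    LinearMap.det (u : complexBetti A.X 1 →ₗ[ℂ] complexBetti A.X 1) = 1 := by
  haveI : Module.Finite ℂ (complexBetti A.X 1) := abelianVarietyCohomologyExteriorH1_holds.finite_one A
  obtain ⟨s, hs, hKs⟩ := id hK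
  rcases Nat.eq_zero_or_pos A.dim with hA | hn
  · have hV : Module.finrank ℂ (complexBetti A.X 1) = 0 := by
      rw [AbelianVariety.finrank_complexBetti_one, hA, mul_zero]
    haveI : Subsingleton (complexBetti A.X 1) := Module.finrank_zero_iff.1 hV
    exact LinearMap.det_eq_one_of_subsingleton _
  have hX : IsSmoothProjective A.dim A.X := AbelianVariety.isSmoothProjective_holds (A := A)
  have h11 : IsOfHodgeType A.dim A.X 2 1 1 h := by
    have e := (hKs.isOfHodgeType_one_one).smul ((s : ℂ)⁻¹)
    rwa [smul_smul, inv_mul_cancel₀ (Complex.ofReal_ne_zero.2 hs.ne'), one_smul] at e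
  have hpow : cupPowTwo h A.dim ≠ 0 := by
    intro h0
    have e := hKs.cupPowTwo_ne_zero hX (p := A.dim) hn le_rfl
    rw [cupPowTwo_smul, h0, smul_zero] at e
    exact e rfl
  have hΛ := AbelianVariety.hasExteriorCohomologyH1_complexPoints A
  have hU2 := exteriorPullback_two_eq_self_of_mem_unitaryCentralizerGroup hQ hK hu hQ h11
  have e := exteriorPullback_cupPowTwo hΛ hU2 A.dim
  rw [exteriorPullback_top hΛ _ (AbelianVariety.finrank_complexBetti_one A)] at e
  exact smul_left_injective ℂ hpow (e.trans (one_smul ℂ _).symm)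

/-- `⋀u` fixes every divisor monomial, non-degenerate form (induction on the degree; `⋀•u` is multiplicative).
[cite: Milne1999LefschetzClasses, Thm. 4.4 (proof, p. 659)] [cite: HatcherAT2002, §3.2 Prop. 3.10] -/
private theorem exteriorPullback_eq_self_of_mem_divisorMonomials_of_nondegenerate {h : complexBetti A.X 2}
    (hh : h ∈ hodgeClassSpan A.dim A.X 1)
    (hnd : ∀ x : complexBetti A.X 1, (∀ y, polarizationPairingOne A.X h (A.dim - 1) x y = 0) → x = 0)
    {u : complexBetti A.X 1 ≃ₗ[ℂ] complexBetti A.X 1} (hu : u ∈ unitaryCentralizerGroup A h) :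
    ∀ (p : ℕ), ∀ c ∈ divisorMonomials A.X A.dim p,
      exteriorPullback (AbelianVariety.hasExteriorCohomologyH1_complexPoints A)
        (u : complexBetti A.X 1 →ₗ[ℂ] complexBetti A.X 1) (2 * p) c = c
  | 0, c, hc => by
    rw [mem_divisorMonomials_zero.1 hc]
    exact exteriorPullback_one _ _
  | p + 1, c, hc => by
    obtain ⟨a, ha, b, hbQ, hb11, rfl⟩ := mem_divisorMonomials_succ.1 hc
    rw [exteriorPullback_cupProduct,
      exteriorPullback_eq_self_of_mem_divisorMonomials_of_nondegenerate hh hnd hu p a ha,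
      exteriorPullback_two_eq_self_of_mem_unitaryCentralizerGroup_of_nondegenerate hh hnd hu hbQ hb11]

/-- **`S(A)(h)` fixes all divisor classes of `A`, for `h ∈ B¹(A) ⊗ ℂ` with `Q_h` NON-DEGENERATE** — the
form of `exteriorPullback_eq_self_of_mem_divisorClassesSpan` whose hypotheses are met by the product
classes `Σᵢ prᵢ^* h` on the powers `A^r` (Milne: "any `γ ∈ G(A)(k^al)` will fix all divisor classes on
`A^r`, all `r`"): for `u ∈ unitaryCentralizerGroup A h` and every `p`, `⋀^{2p}u` fixes every element of
`divisorClassesSpan A.X (dim A) p = D^p_hom(A)_ℂ`.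
[cite: Milne1999LefschetzClasses, Thm. 4.4 (proof, p. 659), §1 pp. 643–644]
[cite: Deligne1982HodgeCycles, I §5 Prop. 5.1 (proof) and I §3 Prop. 3.4] [cite: HatcherAT2002, §3.2 Prop. 3.10] -/
theorem exteriorPullback_eq_self_of_mem_divisorClassesSpan_of_nondegenerate {h : complexBetti A.X 2}
    (hh : h ∈ hodgeClassSpan A.dim A.X 1)
    (hnd : ∀ x : complexBetti A.X 1, (∀ y, polarizationPairingOne A.X h (A.dim - 1) x y = 0) → x = 0)
    {u : complexBetti A.X 1 ≃ₗ[ℂ] complexBetti A.X 1} (hu : u ∈ unitaryCentralizerGroup A h) (p : ℕ)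
    {c : complexBetti A.X (2 * p)} (hc : c ∈ divisorClassesSpan A.X A.dim p) :
    exteriorPullback (AbelianVariety.hasExteriorCohomologyH1_complexPoints A)
      (u : complexBetti A.X 1 →ₗ[ℂ] complexBetti A.X 1) (2 * p) c = c := by
  induction hc using Submodule.span_induction with
  | mem x hx => exact exteriorPullback_eq_self_of_mem_divisorMonomials_of_nondegenerate hh hnd hu p x hx
  | zero => exact map_zero _
  | add x y _ _ hx hy => rw [map_add, hx, hy]
  | smul r x _ hx => rw [map_smul, hx]

/-- **Milne 1999, Theorem 4.4 — "any `γ ∈ G(A)(k^al)` will fix all divisor classes on `A^r`", the case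
`r = 1`, `γ†γ = 1`, PROVED on the carriers.** For every complex abelian variety `A`, every polarization
class `h` (rational, with `s · h` Kähler for some real `s > 0`), every
`u ∈ S(A)(ℂ) = unitaryCentralizerGroup A h` (an automorphism of `H¹(A(ℂ); ℂ)` commuting with `End(A)` and
preserving `Q_h`) and every `p`, the exterior action `⋀^{2p}u` on `H^{2p}(A(ℂ); ℂ) = ⋀^{2p}H¹` fixes every
element of `divisorClassesSpan A.X (dim A) p = D^p_hom(A)_ℂ`, the `ℂ`-span of `p`-fold cup products of
rational `(1,1)`-classes (the Lefschetz classes of `A` in the sense of `Milne1999/LefschetzGroup`). This is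
the first-power part of the inclusion `S(A)(ℂ) ≤ {g₁ | g ∈ specialLefschetzGroup (dim A) A.X}` of the
cited record `Milne1999_thm44_specialLefschetzGroup_one_eq_unitaryCentralizerGroup`; the powers `A^r`,
`r ≥ 2`, go through `exteriorPullback_eq_self_of_mem_divisorClassesSpan_of_nondegenerate` applied to
`A^r` itself. The proof replaces Milne's Néron–Severi ↔ Riemann-form dictionary by Deligne's
description of `End⁰(A) ⊗ ℂ` as the commutant of the Hodge group on `H¹` (granted Riemann's theorem,
PROVED in the tree) — see `apply_contraction_eq_of_mem_unitaryCentralizerGroup`.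
[cite: Milne1999LefschetzClasses, Thm. 4.4 (proof, p. 659), §1 p. 644]
[cite: Deligne1982HodgeCycles, I §5 Prop. 5.1 (proof) and I §3 Prop. 3.4] [cite: HatcherAT2002, §3.2 Prop. 3.10] -/
theorem exteriorPullback_eq_self_of_mem_divisorClassesSpan {h : complexBetti A.X 2}
    (hQ : IsRationalClass h) (hK : ∃ s : ℝ, 0 < s ∧ IsKaehlerClass A.dim A.X ((s : ℂ) • h))
    {u : complexBetti A.X 1 ≃ₗ[ℂ] complexBetti A.X 1} (hu : u ∈ unitaryCentralizerGroup A h) (p : ℕ)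
    {c : complexBetti A.X (2 * p)} (hc : c ∈ divisorClassesSpan A.X A.dim p) :
    exteriorPullback (AbelianVariety.hasExteriorCohomologyH1_complexPoints A)
      (u : complexBetti A.X 1 →ₗ[ℂ] complexBetti A.X 1) (2 * p) c = c := by
  obtain ⟨s, hs, hKs⟩ := hK
  exact exteriorPullback_eq_self_of_mem_divisorClassesSpan_of_nondegenerate
    (mem_hodgeClassSpan_of_isKaehlerClass_smul hQ hs.ne' hKs)
    (eq_zero_of_forall_polarizationPairingOne_eq_zero_of_isKaehlerClass_smul hs.ne' hKs) hu p hc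

end Main

end Literature.AlgebraicGeometry.Milne1999

end
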